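import Mathlib.RingTheory.Polynomial.GaussLemma
import Mathlib.FieldTheory.IntermediateField.Adjoin.Algebra
import Mathlib.RingTheory.EssentialFiniteness
import Mathlib.RingTheory.AdjoinRoot
import Mathlib.FieldTheory.Finite.Extension
import Mathlib.FieldTheory.PrimitiveElement
import Literature.NumberTheory.DiophantineGeometry.FunctionFieldDivisorClasses
import HarnessLib

/-!
# F. K. Schmidt's theorem `∂ = 1` — proof file 1: finite extensions, a bound for `A_n`, and
irreducible polynomials over finite fields

Sibling **proof file** (theorems only; D-0014) of `FunctionFieldSchmidtDegreeOne`, whose named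
fact `minPosDegree_eq_one` is **Stichtenoth Cor. 5.1.11** (F. K. Schmidt 1931): an algebraic
function field `F/𝔽_q` with full constant field `𝔽_q` has `∂ = min {deg A > 0} = 1`. The printed
proof (H. Stichtenoth, *Algebraic Function Fields and Codes*, 2nd ed., GTM 254, §5.1, p. 190;
held copy `book:stichtenothnd-algebraic-function-fields-codes`, text p. 164) compares, for the
constant field extension `F_∂ = F𝔽_{q^∂}`, the pole orders at `t = 1` of `Z_∂(t^∂)` and `Z(t)^∂`
(Prop. 5.1.10, Lemma 5.1.9: every place of `F` splits into `∂` places of `F_∂`). The tree has no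
constant field extensions; the discharge (file `FunctionFieldSchmidtDegreeOneProofs`) runs the same
mechanism with one explicit extension `F' = F(α)`, `μ(α) = 0` for an irreducible `μ ∈ 𝔽_q[T]` of
degree `∂`, and elementary counting of positive divisors in place of poles. This file supplies the
generic ingredients:

* `irreducible_map_of_isIntegrallyClosedIn` — **Stichtenoth Lemma 3.6.2** in polynomial form: if
  `K` is integrally closed in `F`, a monic irreducible `μ ∈ K[T]` stays irreducible in `F[T]`
  (the coefficients of a monic factor are integral over `K`, Mathlib's
  `integralClosure.mem_lifts_of_monic_of_dvd_map`);
* `isAlgFunctionField_of_finiteDimensional` — a finite extension `F'/F` of an algebraic function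
  field of one variable `F/K` is an algebraic function field of one variable over `K`
  (§3.1: `trdeg` is additive and `F'` is finitely generated over `K`); note that `K`
  need not be the full constant field of `F'`, and is not for `F' = F(α)` above;
* `numPosDivisors_le_classNumber_mul_pow` — over a finite constant field `K` which need **not**
  be the full constant field: `A_n ≤ h · q ^ (ℓ(0) + n)` (the `A_n` positive divisors of degree
  `n` lie in at most `h` classes, Prop. 5.1.3 / Lemma 5.1.4 (a), and the class of a positive `A`
  contains at most `|ℒ(A)| = q^{ℓ(A)} ≤ q^{ℓ(0) + deg A}` positive divisors, Lemma 5.1.4 (b) with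
  Lemma 1.4.8) — this only needs Riemann's theorem and the finiteness of the class number, both
  proved in the tree without `IsIntegrallyClosedIn`;
* `exists_irreducible_natDegree_eq`, `exists_ne_aeval_eq_zero` — over a finite field there are
  monic irreducible separable polynomials of every degree `m ≥ 1` (minimal polynomial of a
  primitive element of Mathlib's `FiniteField.Extension K p m`), and such a `μ` of degree `m ≥ 2`
  has two distinct roots in every finite extension `k/K` with `m ∣ [k : K]`
  (`FiniteField.natCard_algHom_of_finrank_dvd`).

## References

* H. Stichtenoth, *Algebraic Function Fields and Codes*, 2nd ed., GTM 254, Springer 2009: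
  Lemma 1.4.8, §3.1, Lemma 3.6.2, Prop. 5.1.3, Lemma 5.1.4, Cor. 5.1.11. [Stichtenoth2009]
-/

noncomputable section

open Polynomial

namespace Literature.NumberTheory.DiophantineGeometry.AlgFunctionField

universe u v w

section Irreducible

variable {K : Type u} {F : Type v} [Field K] [Field F] [Algebra K F]

/-- A monic divisor in `F[X]` of a monic `μ ∈ K[X]` has coefficients in `K` when `K` is integrally
closed in `F` (proof of Stichtenoth Lemma 3.6.2: the coefficients of a monic factor are polynomial
expressions in roots of `μ`, hence integral over `K`; Mathlib
`integralClosure.mem_lifts_of_monic_of_dvd_map`). [cite: Stichtenoth2009, Lemma 3.6.2 (proof)] -/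
theorem exists_map_eq_of_monic_of_dvd_map [IsIntegrallyClosedIn K F] {μ : K[X]} (hμ : μ.Monic)
    {g : F[X]} (hg : g.Monic) (hd : g ∣ μ.map (algebraMap K F)) :
    ∃ g₀ : K[X], g₀.map (algebraMap K F) = g ∧ g₀.Monic := by
  have hlift := integralClosure.mem_lifts_of_monic_of_dvd_map F hμ hg hd
  have hbot : integralClosure K F = ⊥ :=
    (IsIntegrallyClosedIn.integralClosure_eq_bot_iff F (algebraMap K F).injective).mpr ‹_›
  have hlift' : g ∈ Polynomial.lifts (algebraMap K F) := by
    rw [Polynomial.lifts_iff_coeff_lifts] at hlift ⊢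
    intro n
    obtain ⟨c, hc⟩ := hlift n
    have hc' : (c : F) ∈ (⊥ : Subalgebra K F) := hbot ▸ c.2
    obtain ⟨a, ha⟩ := Algebra.mem_bot.mp hc'
    exact ⟨a, by rw [ha, ← hc]; rfl⟩
  obtain ⟨g₀, hg₀, -, hmon⟩ := Polynomial.lifts_and_degree_eq_and_monic hlift' hg
  exact ⟨g₀, hg₀, hmon⟩

/-- **Stichtenoth Lemma 3.6.2** (polynomial form): if `K` is integrally closed in `F` (i.e. `K` is
the full constant field), a monic irreducible `μ ∈ K[X]` stays irreducible in `F[X]`; equivalently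
`[F(α) : F] = [K(α) : K]` for `μ(α) = 0`. [cite: Stichtenoth2009, Lemma 3.6.2] -/
theorem irreducible_map_of_isIntegrallyClosedIn [IsIntegrallyClosedIn K F] {μ : K[X]}
    (hirr : Irreducible μ) (hμ : μ.Monic) : Irreducible (μ.map (algebraMap K F)) := by
  have hμF : (μ.map (algebraMap K F)).Monic := hμ.map _
  refine ⟨fun h => ?_, fun g h hgh => ?_⟩
  · have h1 := natDegree_eq_zero_of_isUnit h
    rw [natDegree_map] at h1
    exact hirr.not_isUnit ((Polynomial.Monic.natDegree_eq_zero hμ).mp h1 ▸ isUnit_one)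
  · have hg0 : g ≠ 0 := fun h0 => hμF.ne_zero (by rw [hgh, h0, zero_mul])
    have hh0 : h ≠ 0 := fun h0 => hμF.ne_zero (by rw [hgh, h0, mul_zero])
    set g₁ := g * C g.leadingCoeff⁻¹ with hg₁
    set h₁ := h * C h.leadingCoeff⁻¹ with hh₁
    have hg₁m : g₁.Monic := monic_mul_leadingCoeff_inv hg0
    have hh₁m : h₁.Monic := monic_mul_leadingCoeff_inv hh0
    have hlc : g.leadingCoeff * h.leadingCoeff = 1 := by
      rw [← leadingCoeff_mul, ← hgh]; exact hμF.leadingCoeff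
    have hprod : μ.map (algebraMap K F) = g₁ * h₁ := by
      rw [hg₁, hh₁, mul_mul_mul_comm, ← C_mul, ← mul_inv, hlc, inv_one, C_1, mul_one, hgh]
    obtain ⟨g₀, hg₀, hg₀m⟩ := exists_map_eq_of_monic_of_dvd_map hμ hg₁m ⟨h₁, hprod⟩
    obtain ⟨h₀, hh₀, hh₀m⟩ := exists_map_eq_of_monic_of_dvd_map hμ hh₁m
      ⟨g₁, by rw [hprod, mul_comm]⟩
    have hμeq : μ = g₀ * h₀ :=
      map_injective (algebraMap K F) (algebraMap K F).injective
        (by rw [Polynomial.map_mul, hg₀, hh₀, hprod])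
    rcases hirr.isUnit_or_isUnit hμeq with hu | hu
    · left
      have h0 : g₁.natDegree = 0 := by
        rw [← hg₀, natDegree_map, natDegree_eq_zero_of_isUnit hu]
      have : g.natDegree = 0 := by
        rw [hg₁, natDegree_mul hg0 (by simp [hg0]), natDegree_C, add_zero] at h0; exact h0
      rw [isUnit_iff_degree_eq_zero, degree_eq_natDegree hg0, this]; rfl
    · right
      have h0 : h₁.natDegree = 0 := by
        rw [← hh₀, natDegree_map, natDegree_eq_zero_of_isUnit hu]
      have : h.natDegree = 0 := by
        rw [hh₁, natDegree_mul hh0 (by simp [hh0]), natDegree_C, add_zero] at h0; exact h0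
      rw [isUnit_iff_degree_eq_zero, degree_eq_natDegree hh0, this]; rfl

end Irreducible

section FiniteExtension

variable {K : Type u} {F : Type v} {F' : Type v} [Field K] [Field F] [Algebra K F]
  [Field F'] [Algebra F F'] [Algebra K F'] [IsScalarTower K F F']

/-- A finite extension `F'` of an algebraic function field of one variable `F/K` is again an
algebraic function field of one variable over `K` (Stichtenoth §3.1, algebraic extensions
of function fields: `trdeg_K F' = trdeg_K F + trdeg_F F' = 1 + 0`, and `F'` is finitely
generated over `K` since `F` is and `[F' : F] < ∞`). `K` need not be the full constant field of
`F'`. [folklore] -/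
theorem isAlgFunctionField_of_finiteDimensional [IsAlgFunctionField K F] [FiniteDimensional F F'] :
    IsAlgFunctionField K F' where
  trdeg_eq_one := by
    haveI : Algebra.IsAlgebraic F F' := Algebra.IsAlgebraic.of_finite F F'
    have h := trdeg_add_eq K F (A := F')
    rw [trdeg_eq_zero (R := F) (A := F'), add_zero,
      IsAlgFunctionField.trdeg_eq_one (K := K) (F := F)] at h
    exact h.symm
  fg_top := by
    haveI : Algebra.EssFiniteType K F :=
      IntermediateField.fg_top_iff.mp (IsAlgFunctionField.fg_top (K := K) (F := F))
    haveI : Algebra.EssFiniteType F F' := inferInstance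
    haveI : Algebra.EssFiniteType K F' := Algebra.EssFiniteType.comp K F F'
    exact IntermediateField.fg_top_iff.mpr this

end FiniteExtension

section UpperBound

variable {K : Type u} {F : Type v} [Field K] [Field F] [Algebra K F]

/-- The positive divisors in the class of a divisor `A` number at most `q ^ ℓ(A)`: each is
`(x) + A` for some `0 ≠ x ∈ ℒ(A)` (Stichtenoth Lemma 5.1.4 (b), the inequality half, valid over any
finite constant field, full or not). [cite: Stichtenoth2009, Lemma 5.1.4(b)] -/
theorem natCard_nonneg_isLinearlyEquivalent_le [Finite K] [IsAlgFunctionField K F]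
    (A : Divisor K F) :
    Nat.card {D : Divisor K F // 0 ≤ D ∧ D.IsLinearlyEquivalent A} ≤ Nat.card K ^ ell A := by
  set L := riemannRochSpace (K := K) A with hL
  haveI : FiniteDimensional K L := finiteDimensional_riemannRochSpace_of_isAlgFunctionField A
  haveI : Finite L := Module.finite_of_finite K
  -- choose, for each `D`, a function `x` with `(x) = D - A`
  have hx : ∀ D : {D : Divisor K F // 0 ≤ D ∧ D.IsLinearlyEquivalent A},
      ∃ x : L, (x : F) ≠ 0 ∧ principalDivisor K (x : F) = D.1 - A := by
    rintro ⟨D, hD, x, hx0, hxD⟩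
    have hxL : x ∈ L := by
      rw [hL, mem_riemannRochSpace_iff_nonneg A hx0, hxD, sub_add_cancel]
      exact hD
    exact ⟨⟨x, hxL⟩, hx0, hxD⟩
  choose f hf0 hf using hx
  have hinj : Function.Injective f := by
    intro D D' h
    apply Subtype.ext
    have h1 := hf D
    rw [h, hf D'] at h1
    exact (sub_left_inj.mp h1).symm
  calc Nat.card {D : Divisor K F // 0 ≤ D ∧ D.IsLinearlyEquivalent A}
      ≤ Nat.card L := Nat.card_le_card_of_injective f hinj
    _ = Nat.card K ^ ell A := by rw [ell, ← hL]; exact Module.natCard_eq_pow_finrank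

/-- **Upper bound for the numbers `A_n`** over a finite constant field which need not be the full
constant field: `A_n ≤ h · q ^ (ℓ(0) + n)`. The `A_n` positive divisors of degree `n` fall into
at most `h` classes (Stichtenoth Prop. 5.1.3 / Lemma 5.1.4 (a), (c)), and the class of a positive
divisor `A` of degree `n` contains at most `q ^ ℓ(A) ≤ q ^ (ℓ(0) + n)` positive divisors
(Lemma 5.1.4 (b) and Lemma 1.4.8). [cite: Stichtenoth2009, Lemma 5.1.4 and Lemma 1.4.8] -/
theorem numPosDivisors_le_classNumber_mul_pow [Finite K] [IsAlgFunctionField K F] (n : ℕ) :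
    numPosDivisors K F n ≤ classNumber K F * Nat.card K ^ (ell (0 : Divisor K F) + n) := by
  set T := {D : Divisor K F // 0 ≤ D ∧ D.degree = n} with hT
  set Cl := classesOfDegree (K := K) (F := F) n with hCl
  haveI : Fintype Cl := Fintype.ofFinite Cl
  set B : ℕ := Nat.card K ^ (ell (0 : Divisor K F) + n) with hB
  -- the class map `T → Clⁿ`
  let π : T → Cl := fun D => ⟨DivisorClass.mk D.1, by
    rw [hCl, mem_classesOfDegree, DivisorClass.degree_mk, D.2.2]⟩
  -- each fibre has at most `B` elements
  have hfib : ∀ c : Cl, Nat.card {D : T // π D = c} ≤ B := by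
    intro c
    by_cases hc : IsEmpty {D : T // π D = c}
    · rw [Nat.card_of_isEmpty]; exact Nat.zero_le _
    rw [not_isEmpty_iff] at hc
    obtain ⟨⟨D₀, hD₀⟩⟩ := hc
    have hA : 0 ≤ D₀.1 := D₀.2.1
    -- the fibre injects into the positive divisors of the class of `D₀`
    let g : {D : T // π D = c} → {D : Divisor K F // 0 ≤ D ∧ D.IsLinearlyEquivalent D₀.1} :=
      fun D => ⟨D.1.1, D.1.2.1, DivisorClass.mk_eq_mk_iff.mp (by
        have h1 := congrArg Subtype.val D.2
        have h2 := congrArg Subtype.val hD₀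
        exact h1.trans h2.symm)⟩
    have hg : Function.Injective g := fun D D' h =>
      Subtype.ext (Subtype.ext (congrArg (fun x => x.1) h))
    haveI : Finite {D : Divisor K F // 0 ≤ D ∧ D.IsLinearlyEquivalent D₀.1} := by
      refine Finite.of_injective (fun D => (⟨D.1, D.2.1, by
        rw [Divisor.degree_eq_of_isLinearlyEquivalent D.2.2, D₀.2.2]⟩ : T)) fun D D' h =>
        Subtype.ext ?_
      have := congrArg Subtype.val h
      exact this
    have hℓ : ell D₀.1 ≤ ell (0 : Divisor K F) + n := by
      have h1 := ell_add_le_of_nonneg (0 : Divisor K F) hA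
      rw [zero_add, D₀.2.2] at h1
      exact_mod_cast h1
    calc Nat.card {D : T // π D = c}
        ≤ Nat.card {D : Divisor K F // 0 ≤ D ∧ D.IsLinearlyEquivalent D₀.1} :=
          Nat.card_le_card_of_injective g hg
      _ ≤ Nat.card K ^ ell D₀.1 := natCard_nonneg_isLinearlyEquivalent_le D₀.1
      _ ≤ B := Nat.pow_le_pow_right Nat.card_pos hℓ
  -- the number of classes of degree `n` is at most `h`
  have hCl_le : Nat.card Cl ≤ classNumber K F := by
    by_cases hdvd : (minPosDegree K F : ℤ) ∣ (n : ℤ)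
    · exact (natCard_classesOfDegree_of_dvd hdvd).le
    · rw [hCl, classesOfDegree_eq_empty_of_not_dvd hdvd, Nat.card_eq_fintype_card]
      simp
  -- sum over the fibres
  have hsum : Nat.card T = ∑ c : Cl, Nat.card {D : T // π D = c} := by
    rw [← Nat.card_sigma]
    exact Nat.card_congr (Equiv.sigmaFiberEquiv π).symm
  calc numPosDivisors K F n = Nat.card T := rfl
    _ = ∑ c : Cl, Nat.card {D : T // π D = c} := hsum
    _ ≤ ∑ _c : Cl, B := Finset.sum_le_sum fun c _ => hfib c
    _ = Nat.card Cl * B := by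
      rw [Finset.sum_const, Finset.card_univ, smul_eq_mul, Nat.card_eq_fintype_card]
    _ ≤ classNumber K F * B := Nat.mul_le_mul_right _ hCl_le

end UpperBound

section FiniteFieldPolynomials

/-- Over a finite field there are monic irreducible (separable) polynomials of every positive
degree: the minimal polynomial of a primitive element of the extension of degree `m`
(Mathlib's `FiniteField.Extension`). [folklore] -/
theorem exists_irreducible_natDegree_eq (K : Type u) [Field K] [Finite K] {m : ℕ} (hm : 0 < m) :
    ∃ μ : K[X], μ.Monic ∧ Irreducible μ ∧ μ.Separable ∧ μ.natDegree = m := by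
  haveI : Fact (ringChar K).Prime := ⟨CharP.char_is_prime K (ringChar K)⟩
  haveI : NeZero m := ⟨hm.ne'⟩
  let E := FiniteField.Extension K (ringChar K) m
  obtain ⟨α, hα⟩ := Field.exists_primitive_element K E
  have hint : IsIntegral K α := .of_finite K α
  refine ⟨minpoly K α, minpoly.monic hint, minpoly.irreducible hint,
    Algebra.IsSeparable.isSeparable K α, ?_⟩
  rw [← IntermediateField.adjoin.finrank hint, hα, IntermediateField.finrank_top',
    FiniteField.finrank_extension]

/-- An irreducible separable `μ ∈ K[X]` of degree `m ≥ 2` has two distinct roots in every finite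
extension `k/K` with `m ∣ [k : K]` (there are `m = |Hom_K(K[X]/(μ), k)|` of them). [folklore] -/
theorem exists_ne_aeval_eq_zero {K : Type u} {k : Type v} [Field K] [Field k] [Algebra K k]
    [Finite k] {μ : K[X]} (hμ : Irreducible μ) (h2 : 2 ≤ μ.natDegree)
    (hdvd : μ.natDegree ∣ Module.finrank K k) :
    ∃ a b : k, a ≠ b ∧ aeval a μ = 0 ∧ aeval b μ = 0 := by
  haveI := Fact.mk hμ
  have hdim : Module.finrank K (AdjoinRoot μ) = μ.natDegree := by
    rw [(AdjoinRoot.powerBasis hμ.ne_zero).finrank, AdjoinRoot.powerBasis_dim]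
  have hcard := FiniteField.natCard_algHom_of_finrank_dvd (K := AdjoinRoot μ) (L := k)
    (hdim ▸ hdvd)
  rw [hdim] at hcard
  haveI : Finite (AdjoinRoot μ →ₐ[K] k) := Nat.finite_of_card_ne_zero (by omega)
  haveI : Nontrivial (AdjoinRoot μ →ₐ[K] k) := by
    rw [← Finite.one_lt_card_iff_nontrivial]; omega
  obtain ⟨ψ₁, ψ₂, hne⟩ := exists_pair_ne (AdjoinRoot μ →ₐ[K] k)
  have hroot : ∀ ψ : AdjoinRoot μ →ₐ[K] k, aeval (ψ (AdjoinRoot.root μ)) μ = 0 := fun ψ => by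
    rw [aeval_algHom_apply, AdjoinRoot.aeval_eq, AdjoinRoot.mk_self, map_zero]
  refine ⟨ψ₁ (AdjoinRoot.root μ), ψ₂ (AdjoinRoot.root μ), fun h => hne ?_, hroot ψ₁, hroot ψ₂⟩
  exact AdjoinRoot.algHom_ext h

end FiniteFieldPolynomials



end Literature.NumberTheory.DiophantineGeometry.AlgFunctionField

end
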